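import Literature.Computability.Cryptography.HILLHashedFunction
import HarnessLib

/-!
# HILL's hashed function `f'` for a PARAMETRISED one-way function: the program `G2C ⟨⟨1^N, y⟩, w ‖ r⟩ = g f_y (w ‖ r)`

Håstad–Impagliazzo–Levin–Luby (SIAM J. Comput. 28 (1999), §6.1 eq. (3)) hash the input of a one-way function
`f`; Allender et al. (SIAM J. Comput. 35 (2006), §4.1 and Thm. 44) apply the whole construction to a
**parametrised** function `f(y, x)` "computable uniformly in time polynomial in `|x|`", the parameter `y`
being a public input of every machine of the reduction. The tree's program `HILL.G2 f` (`HILLHashedFunction.lean`: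
`G2 f ⟨1^N, w ‖ r⟩ = g f (w ‖ r)`, `G2_mem_FP (hf : f ∈ FP)`) takes `f` as an opaque `FP` brick, so for the
sections `f_y = F ⟨y, ·⟩` of a two-argument `F ∈ FP` it yields one machine PER `y`. This file gives the
uniform program: **`HILL.G2C F ⟨⟨1^N, y⟩, w ‖ r⟩ = g (f_y) (w ‖ r)`** with `f_y x = F ⟨y, x⟩`
(`G2C_apply`), in `FP` for `F ∈ FP` (`G2C_mem_FP`) — the same pipeline with the context `y` carried in the
header and routed to the one call of `F`. It is the sampler of `f'` used by the relativised, parametrised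
port of HILL's reductions (`HILLHidingOracle.lean` and sequels).

## References

* J. Håstad, R. Impagliazzo, L. A. Levin, M. Luby, SIAM J. Comput. 28 (1999), §6.1 eq. (3).
* E. Allender, H. Buhrman, M. Koucký, D. van Melkebeek, D. Ronneburger, SIAM J. Comput. 35 (2006), §4.1
  (the standing hypotheses on `f(y, x)`), Thm. 44.
-/

noncomputable section

namespace Literature.Computability.Cryptography

open _root_.Computability Complexity Complexity.Brick Complexity.Plumb Complexity.OracleCompose Polynomial AffineStr

namespace HILL

namespace G2Ctx

variable (F : List Bool → List Bool)

/-! Records `⟨⟨1^N, y⟩, v⟩` with `v = w ‖ r`. -/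

/-- `1^N`. [folklore] -/
def uF : List Bool → List Bool := fstF ∘ fstF
/-- The parameter `y`. [folklore] -/
def yF : List Bool → List Bool := sndF ∘ fstF
/-- `⟨1^N, ε⟩`, the argument shape of the level bricks. [folklore] -/
def LV : List Bool → List Bool := fanoutFn uF fun _ => []
/-- `1^{b(N)}`. [folklore] -/
def bUc : List Bool → List Bool := bU ∘ LV
/-- `1^{n(N)}`. [folklore] -/
def nUc : List Bool → List Bool := nU ∘ LV
/-- `1^{eLen N}`. [folklore] -/
def eUc : List Bool → List Bool := eU ∘ LV
/-- `1^{hLen N}`. [folklore] -/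
def hUc : List Bool → List Bool := hU ∘ LV
/-- `w = v ↾ N`. [folklore] -/
def wF : List Bool → List Bool := takeFn ∘ fanoutFn uF sndF
/-- `r = v ⇂ N`. [folklore] -/
def rF : List Bool → List Bool := dropFn ∘ fanoutFn uF sndF
/-- `x = w ↾ n(N)`. [folklore] -/
def xF : List Bool → List Bool := takeFn ∘ fanoutFn nUc wF
/-- `ι = w ⇂ n(N)`. [folklore] -/
def ibF : List Bool → List Bool := dropFn ∘ fanoutFn nUc wF
/-- `h_r(x)`. [folklore] -/
def hashF : List Bool → List Bool := AffineProg.hashFn ∘ fanoutFn (fanoutFn nUc hUc) (fanoutFn rF xF)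
/-- `1^{⟦ι⟧}` (ruler `1^N 1^N 1 1`). [folklore] -/
def iU : List Bool → List Bool := binToUnaryFn ∘ fanoutFn (concatFn ∘ fanoutFn (concatFn ∘ fanoutFn uF uF) (fun _ => ones 2)) ibF
/-- `1^{⟦ι⟧ + eLen N}`. [folklore] -/
def tU : List Bool → List Bool := concatFn ∘ fanoutFn iU eUc
/-- The masked hash. [folklore] -/
def maskF : List Bool → List Bool :=
  concatFn ∘ fanoutFn (takeFn ∘ fanoutFn tU hashF) (Kannan.zerosFn ∘ dropFn ∘ fanoutFn tU hUc)
/-- **The call of `F` on `⟨y, x⟩`** — the only place the parameter is used. [cite: AllenderEtAl2006, §4.1 (f(y, x) computable uniformly)] -/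
def fyF : List Bool → List Bool := F ∘ fanoutFn yF xF

end G2Ctx

/-- **The uniform program `G2C F`** for `g (f_y)` with the parameter in the header. [cite: HastadImpagliazzoLevinLuby1999, §6.1 eq. (3)] -/
def G2C (F : List Bool → List Bool) : List Bool → List Bool :=
  concatFn ∘ fanoutFn (concatFn ∘ fanoutFn (concatFn ∘ fanoutFn (G2Ctx.fyF F) G2Ctx.maskF) G2Ctx.ibF) G2Ctx.rF

namespace G2Ctx

variable {F}

/-- `|1ⁿ| = n`. [folklore] -/
private theorem length_unary (n : ℕ) : (unaryEncodeNat n).length = n := unary_decode_encode_nat n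

/-- **`G2C` computes `g (f_y)`**: `G2C F ⟨⟨1^N, y⟩, w ‖ r⟩ = g (fun x => F ⟨y, x⟩) (w ‖ r)` for `|w| = N`,
`|r| = rlen N`. [cite: HastadImpagliazzoLevinLuby1999, §6.1 eq. (3)] -/
theorem G2C_apply (y : List Bool) {N : ℕ} {w ρ : List Bool} (hw : w.length = N) (hρ : ρ.length = rlen N) :
    G2C F (boolPair (boolPair (unaryEncodeNat N) y) (w ++ ρ)) = g (fun x => F (boolPair y x)) (w ++ ρ) := by
  set z := boolPair (boolPair (unaryEncodeNat N) y) (w ++ ρ) with hz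
  have hN := length_unary N
  have hu : uF z = unaryEncodeNat N := by simp [uF, hz]
  have hy : yF z = y := by simp [yF, hz]
  have hLV : LV z = boolPair (unaryEncodeNat N) [] := by rw [LV, fanoutFn_apply, hu]
  have hb : bUc z = ones (bLen N) := by rw [bUc, Function.comp_apply, hLV, bU_pair]
  have hn : nUc z = ones (nLen N) := by rw [nUc, Function.comp_apply, hLV, nU_pair]
  have he : eUc z = ones (eLen N) := by rw [eUc, Function.comp_apply, hLV, eU_pair]
  have hh : hUc z = ones (hLen N) := by rw [hUc, Function.comp_apply, hLV, hU_pair]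
  have hwF : wF z = w := by
    rw [wF, Function.comp_apply, fanoutFn_apply, hu, hz, sndF_boolPair, takeFn_boolPair, hN, List.take_left' hw]
  have hrF : rF z = ρ := by
    rw [rF, Function.comp_apply, fanoutFn_apply, hu, hz, sndF_boolPair, dropFn_boolPair, hN, List.drop_left' hw]
  have hxF : xF z = xOf w := by
    rw [xF, Function.comp_apply, fanoutFn_apply, hn, hwF, takeFn_boolPair, xOf, hw]; simp [ones]
  have hib : ibF z = iBits w := by
    rw [ibF, Function.comp_apply, fanoutFn_apply, hn, hwF, dropFn_boolPair, iBits, hw]; simp [ones]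
  have hhash : hashF z = hashStr (nLen N) (hLen N) ρ (xOf w) := by
    rw [hashF, Function.comp_apply, fanoutFn_apply, fanoutFn_apply, fanoutFn_apply, hn, hh, hrF, hxF, AffineProg.hashFn_boolPair]
  have hi : iU z = ones (icap N (iBits w)) := by
    rw [iU, Function.comp_apply, fanoutFn_apply, Function.comp_apply, fanoutFn_apply, Function.comp_apply, fanoutFn_apply, hu, hib,
      concatFn_boolPair, concatFn_boolPair, binToUnaryFn_boolPair, icap]
    simp only [List.length_append, hN, ones, List.length_replicate, two_mul]
  have ht : tU z = ones (icap N (iBits w) + eLen N) := by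
    rw [tU, Function.comp_apply, fanoutFn_apply, hi, he, concatFn_boolPair, Com.ones_append]
  have hmask : maskF z = maskTo N (icap N (iBits w)) (hashStr (nLen N) (hLen N) ρ (xOf w)) := by
    rw [maskF, Function.comp_apply, fanoutFn_apply, Function.comp_apply, fanoutFn_apply, ht, hhash, takeFn_boolPair,
      Function.comp_apply, Function.comp_apply, fanoutFn_apply, ht, hh, dropFn_boolPair, Kannan.zerosFn_apply, concatFn_boolPair,
      maskTo]
    simp [ones]
  have hfy : fyF F z = F (boolPair y (xOf w)) := by rw [fyF, Function.comp_apply, fanoutFn_apply, hy, hxF]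
  rw [G2C, Function.comp_apply, fanoutFn_apply, Function.comp_apply, fanoutFn_apply, Function.comp_apply, fanoutFn_apply,
    hfy, hmask, hib, hrF, concatFn_boolPair, concatFn_boolPair, concatFn_boolPair, g_append hw hρ, body]

/-- **`G2C F ∈ FP`** for `F ∈ FP`. [Arora–Barak 2009, §1.3] [folklore] -/
theorem G2C_mem_FP (hF : F ∈ FP) : G2C F ∈ FP := by
  have hu : uF ∈ FP := comp_mem_FP fstF_mem_FP fstF_mem_FP
  have hy : yF ∈ FP := comp_mem_FP sndF_mem_FP fstF_mem_FP
  have hLV : LV ∈ FP := fanoutFn_mem_FP hu (const_mem_FP _)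
  have hb0 : bU ∈ FP := comp_mem_FP (cons_mem_FP true) (comp_mem_FP logFn_mem_FP fstF_mem_FP)
  have hn0 : nU ∈ FP := comp_mem_FP dropFn_mem_FP (fanoutFn_mem_FP hb0 fstF_mem_FP)
  have he0 : eU ∈ FP := comp_mem_FP concatFn_mem_FP (fanoutFn_mem_FP (comp_mem_FP concatFn_mem_FP (fanoutFn_mem_FP hb0 hb0)) (const_mem_FP _))
  have hh0 : hU ∈ FP := comp_mem_FP concatFn_mem_FP (fanoutFn_mem_FP hn0 he0)
  have hn : nUc ∈ FP := comp_mem_FP hn0 hLV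
  have he : eUc ∈ FP := comp_mem_FP he0 hLV
  have hh : hUc ∈ FP := comp_mem_FP hh0 hLV
  have hw : wF ∈ FP := comp_mem_FP takeFn_mem_FP (fanoutFn_mem_FP hu sndF_mem_FP)
  have hr : rF ∈ FP := comp_mem_FP dropFn_mem_FP (fanoutFn_mem_FP hu sndF_mem_FP)
  have hx : xF ∈ FP := comp_mem_FP takeFn_mem_FP (fanoutFn_mem_FP hn hw)
  have hib : ibF ∈ FP := comp_mem_FP dropFn_mem_FP (fanoutFn_mem_FP hn hw)
  have hhash : hashF ∈ FP := comp_mem_FP AffineProg.hashFn_mem_FP (fanoutFn_mem_FP (fanoutFn_mem_FP hn hh) (fanoutFn_mem_FP hr hx))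
  have hi : iU ∈ FP := comp_mem_FP binToUnaryFn_mem_FP (fanoutFn_mem_FP (comp_mem_FP concatFn_mem_FP (fanoutFn_mem_FP
    (comp_mem_FP concatFn_mem_FP (fanoutFn_mem_FP hu hu)) (const_mem_FP _))) hib)
  have ht : tU ∈ FP := comp_mem_FP concatFn_mem_FP (fanoutFn_mem_FP hi he)
  have hmask : maskF ∈ FP := comp_mem_FP concatFn_mem_FP (fanoutFn_mem_FP (comp_mem_FP takeFn_mem_FP (fanoutFn_mem_FP ht hhash))
    (comp_mem_FP Kannan.zerosFn_mem_FP (comp_mem_FP dropFn_mem_FP (fanoutFn_mem_FP ht hh))))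
  have hfy : fyF F ∈ FP := comp_mem_FP hF (fanoutFn_mem_FP hy hx)
  exact comp_mem_FP concatFn_mem_FP (fanoutFn_mem_FP (comp_mem_FP concatFn_mem_FP (fanoutFn_mem_FP
    (comp_mem_FP concatFn_mem_FP (fanoutFn_mem_FP hfy hmask)) hib)) hr)

end G2Ctx

end HILL

end Literature.Computability.Cryptography

end
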